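import Literature.NumberTheory.GelbartRogawski1991.LocalDoubledUnitarySplittingBasics
import Literature.NumberTheory.GelbartRogawski1991.LocalDoubledUnitarySmoothSplit
import HarnessLib

-- buildfix G11b-3 recipe (LEDGER B13-1/B13-3): elaborate sequentially so the trailing `attribute [implicit_reducible]`
-- block (reducibilityCoreExt is keyed to the async environment branch) is in force at `.olean` export.
set_option Elab.async false

/-!
# The local splitting data of the doubled unitary group, II: the split places
# ([Kudla1994, Thm 3.1]; [HarrisKudlaSweet1996, §1 (1.15)–(1.16)]; [GelbartRogawski1991, §3.1 Prop. 3.1.1])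

Topic `NumberTheory/GelbartRogawski1991`; namespace
`Literature.NumberTheory.GelbartRogawski1991.UnitaryDualPair.LocalSplitting` (sequel of `LocalDoubledUnitarySplittingBasics`; the non-split places are `LocalDoubledUnitarySplittingData`).
KERNEL construction: every `def` has a body, every theorem is proved.

* the datum at a SPLIT place: `betaSplitDoubled` (`β = λ_m(ι ·) · χ_w(det ·_w)`), `IsSplitPair`, L1s′ `L1s_parabolic`,
  `betaSplitDoubled_mul`, L6s `L6s_smooth`, `localSplittingDatumSplit`, L8s `L8s_parabolicNormalised`.
* `chiDet_inv`: inverting the local characters inverts `χ_v(det_Δ ·)`.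
(The unramified clauses L7 / L7s and the CM specialisation are the sequel `LocalDoubledUnitarySplittingDataCM`.)

Stage-1 cell `pub-hodgecm`, seat GR-1 (2026-08-21). Nothing in this file is a claim of the manuscripts adjudicated by that cell.

## References

* S. S. Kudla, *Splitting metaplectic covers of dual reductive pairs*, Israel J. Math. 87 (1994) 361–401, §3, Thm 3.1
  [Kudla1994].
* M. Harris, S. S. Kudla, W. J. Sweet, *Theta dichotomy for unitary groups*, J. Amer. Math. Soc. 9 (1996) 941–1004,
  §1 (1.11)–(1.16) [HarrisKudlaSweet1996].
* S. Gelbart, J. Rogawski, *L-functions and Fourier–Jacobi coefficients for the unitary group U(3)*, Invent. Math. 105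
  (1991), §3.1 Prop. 3.1.1, (3.1.3) [GelbartRogawski1991].
* R. Ranga Rao, *On some explicit formulas in the theory of Weil representation*, Pacific J. Math. 157 (1993), Thm 4.1
  [Rangarao1993].
* C. Mœglin, M.-F. Vignéras, J.-L. Waldspurger, *Correspondances de Howe sur un corps p-adique*, LNM 1291 (1987),
  Chap. 2 II.8, II.10, Chap. 3 §I.3 [MoeglinVignerasWaldspurger1987].
* A. Weil, *Sur certains groupes d'opérateurs unitaires*, Acta Math. 111 (1964), n° 32 [Weil1964].
-/

set_option autoImplicit false

noncomputable section

open NumberField IsDedekindDomain MeasureTheory Matrix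
open Literature.RepresentationTheory.HeisenbergGroup
open Literature.NumberTheory.Automorphic Literature.NumberTheory.Automorphic.UnitaryGroup Literature.NumberTheory.Weil1964
open Literature.NumberTheory.GaloisRepresentations.IsNonarchimedeanLocalField
open Literature.GroupTheory Literature.LinearAlgebra.QuadraticForm
open Literature.NumberTheory.GelbartRogawski1991.AdaptedBlocks

namespace Literature.NumberTheory.GelbartRogawski1991.UnitaryDualPair.LocalSplitting

variable (F : Type) [Field F] [NumberField F] (E : Type) [Field E] [NumberField E] [Algebra F E]
  [Algebra.IsQuadraticExtension F E] (c : E ≃ₐ[F] E)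
  {δ : E} (hcδ : c δ = -δ) (hδ : δ ≠ 0) {d : F} (hd : δ * δ = algebraMap F E d)
  (v : HeightOneSpectrum (𝓞 F))
  [MeasurableSpace (v.adicCompletion F)] [BorelSpace (v.adicCompletion F)]
  (μ : Measure (v.adicCompletion F)) [μ.IsAddHaarMeasure]

section Doubled

variable (n : ℕ) {T₀ : Matrix (Fin n) (Fin n) F}

/-! ### The datum at a SPLIT place (L1 + L1s), normalised on `P_Δ` -/

/-- **`β_v` at a SPLIT place of the doubled datum, NORMALISED**: `β(g) := λ_m(ι g) · χ_w(det g_w)` — the stabiliser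
function (at the section's character `ψ'`) of the `ι(H(F_v))`-stable Lagrangian `m` of L1s times the CHARACTER
`χ_w ∘ det ∘ pr_w` of `H(F_v) ≅ GL_{2n}(E_w)` (which does not change `∂β` and produces the prescribed values
`χ_v(det_Δ p)` on `P_Δ`, L1s′). [cite: Kudla1994, Thm 3.1; HarrisKudlaSweet1996, §1 (1.15)] -/
def betaSplitDoubled (hT₀ : T₀.IsSymm) (hT₀d : IsUnit T₀.det) {JD : Matrix (Fin (n + n)) (Fin (n + n)) E} (hJD : JD = (gramD F n T₀).map (algebraMap F E))
    (w : PlacesOver E v) (hw : c • w.1 ≠ w.1)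
    {ψ' : AddChar (HeightOneSpectrum.adicCompletion F v) Circle} (hψ' : ψ'.IsContinuousNontrivial)
    (χv : ∀ w : PlacesOver E v, (w.1.adicCompletion E)ˣ →* ℂˣ)
    (g : UnitaryGroup.localPi E c (n + n) JD v) : ℂˣ :=
  betaSplit F E c hcδ hδ hd v μ (n + n) (gramD F n T₀) (gramD_isSymm F n hT₀) (isUnit_det_gramD F n hT₀d) hJD hψ'
      (deltaLagrangian F v n) w hw g *
    χv w (Matrix.GeneralLinearGroup.det ((g : UnitaryGroup.LocalGLPi E (n + n) v) w))

/-- **the tie between the two local characters above a split place**: `χ_{c⁻¹w} = χ_w⁻¹ ∘ c_*` on `E_{c⁻¹w}ˣ`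
(`c_* : E_{c⁻¹w} ≃ E_w`) — the component at a split `v` of `χ|_{𝔸_F^×} = ε_{E/F}` (`ε_v = 1` at split `v`) for the
Hecke character `χ` of `E` of [GelbartRogawski1991, §3.1]. [cite: HarrisKudlaSweet1996, §1 (1.15)] -/
def IsSplitPair (w : PlacesOver E v) (χv : ∀ w : PlacesOver E v, (w.1.adicCompletion E)ˣ →* ℂˣ) : Prop :=
  ∀ x : ((PlacesOver.galInv c w).1.adicCompletion E)ˣ,
    χv (PlacesOver.galInv c w) x = (χv w (Units.map (galAdicCompletionMap c (smul_inv_smul c w.1)).toMonoidHom x))⁻¹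

/-- **L1s′**: at a split place the normalised `β` takes the prescribed values on `P_Δ(F_v)`:
`λ_m(ι p) = μ(ℓ_Δ, ℓ_Δ, m) = 1` (`betaSplit_eq_one_of_map_eq`) and `χ_w(det p_w) = χ_w(det_Δ p_w) · χ_{c⁻¹w}(det_Δ
p_{c⁻¹w})` (tree `chi_det_eq_chiDet` of `LocalDoubledUnitarySplitParabolic`: block-triangularity of `p_w` in the
`Δ`-adapted frame, the unitarity relation `(c_* p_{c⁻¹w})ᵀ J p_w = J` between the two components, and the tie
`IsSplitPair`). [cite: Kudla1994, Thm 3.1; HarrisKudlaSweet1996, §1 (1.15)] -/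
theorem L1s_parabolic (hT₀ : T₀.IsSymm) (hT₀d : IsUnit T₀.det) {JD : Matrix (Fin (n + n)) (Fin (n + n)) E} (hJD : JD = (gramD F n T₀).map (algebraMap F E))
    (w : PlacesOver E v) (hw : c • w.1 ≠ w.1)
    {ψ' : AddChar (HeightOneSpectrum.adicCompletion F v) Circle} (hψ' : ψ'.IsContinuousNontrivial)
    (χv : ∀ w : PlacesOver E v, (w.1.adicCompletion E)ˣ →* ℂˣ) (hχ : IsSplitPair F E c v w χv)
    (p : UnitaryGroup.localPi E c (n + n) JD v) (hp : IsSiegelDelta F E c hcδ hδ hd v n hT₀ hJD p) :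
    betaSplitDoubled F E c hcδ hδ hd v μ n hT₀ hT₀d hJD w hw hψ' χv p = chiDet F E c v n χv p := by
  rw [betaSplitDoubled, betaSplit_eq_one_of_map_eq F E c hcδ hδ hd v μ (n + n) (gramD F n T₀) (gramD_isSymm F n hT₀)
    (isUnit_det_gramD F n hT₀d) hJD hψ' (deltaLagrangian_orthogonal F v n T₀ hT₀d) w hw p hp, one_mul]
  exact chi_det_eq_chiDet F E c hcδ hδ hd v n hT₀ hT₀d hJD w hw χv hχ p hp

/-- **`∂β = c_r ∘ ι` for the NORMALISED `β` at a split place**: the stabiliser identity (`betaSplit_mul`) times the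
multiplicativity of the character `χ_w ∘ det ∘ pr_w`. KERNEL. [cite: Kudla1994, Thm 3.1] -/
theorem betaSplitDoubled_mul (hT₀ : T₀.IsSymm) (hT₀d : IsUnit T₀.det) {JD : Matrix (Fin (n + n)) (Fin (n + n)) E} (hJD : JD = (gramD F n T₀).map (algebraMap F E))
    (w : PlacesOver E v) (hw : c • w.1 ≠ w.1)
    (χv : ∀ w : PlacesOver E v, (w.1.adicCompletion E)ˣ →* ℂˣ)
    (hU : ImplementerUniqueUpToScalar (localSchrodinger F (n + n) (gramD F n T₀) v))
    (r : ImplementerSection (localSchrodinger F (n + n) (gramD F n T₀) v))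
    {ψ' : AddChar (HeightOneSpectrum.adicCompletion F v) Circle} (hψ' : ψ'.IsContinuousNontrivial)
    (hr : ∀ g₁ g₂ : LocalSp F (n + n) (gramD F n T₀) v, r.cocycle hU g₁ g₂ =
      localLeray F (n + n) (gramD F n T₀) (isUnit_det_gramD F n hT₀d) v μ ψ' hψ' (deltaLagrangian F v n)
        (deltaLagrangian_orthogonal F v n T₀ hT₀d) g₁ g₂)
    (g₁ g₂ : UnitaryGroup.localPi E c (n + n) JD v) :
    betaSplitDoubled F E c hcδ hδ hd v μ n hT₀ hT₀d hJD w hw hψ' χv (g₁ * g₂) *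
        r.cocycle hU (iotaD F E c hcδ hδ hd v n hT₀ hJD g₁) (iotaD F E c hcδ hδ hd v n hT₀ hJD g₂) =
      betaSplitDoubled F E c hcδ hδ hd v μ n hT₀ hT₀d hJD w hw hψ' χv g₁ *
        betaSplitDoubled F E c hcδ hδ hd v μ n hT₀ hT₀d hJD w hw hψ' χv g₂ := by
  have h := congrArg Units.val (betaSplit_mul F E c hcδ hδ hd v μ (n + n) (gramD F n T₀) (gramD_isSymm F n hT₀)
    (isUnit_det_gramD F n hT₀d) hJD hψ' (deltaLagrangian_orthogonal F v n T₀ hT₀d) w hw g₁ g₂)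
  apply Units.ext
  rw [hr]
  simp only [betaSplitDoubled, Subgroup.coe_mul, Pi.mul_apply, _root_.map_mul, Units.val_mul] at h ⊢
  linear_combination (((χv w (Matrix.GeneralLinearGroup.det ((g₁ : UnitaryGroup.LocalGLPi E (n + n) v) w)) : ℂˣ) : ℂ) *
    ((χv w (Matrix.GeneralLinearGroup.det ((g₂ : UnitaryGroup.LocalGLPi E (n + n) v) w)) : ℂˣ) : ℂ)) * h

/-- **L6s — smoothness at a split place**: `H(F_v) ≅ GL_{2n}(E_w)`
(`localPiSplitEquiv`), so the `GL` Iwahori factorisation is a factorisation inside `H`; `β(p) = λ_m(ιp) χ_w(det p_w)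
= χ_w(det p_w)` on `P_Δ` (`betaSplit_eq_one_of_map_eq`), `χ_w` trivial near `1`; then as at a non-split place
(tree `smooth_of_parabolicSmooth_split` of `LocalDoubledUnitarySmoothSplit`). [MoeglinVignerasWaldspurger1987, Chap. 2 II.8] [cite: MoeglinVignerasWaldspurger1987, Chap. 2 II.8] -/
theorem L6s_smooth (hT₀ : T₀.IsSymm) (hT₀d : IsUnit T₀.det) {JD : Matrix (Fin (n + n)) (Fin (n + n)) E} (hJD : JD = (gramD F n T₀).map (algebraMap F E))
    (w : PlacesOver E v) (hw : c • w.1 ≠ w.1)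
    (χv : ∀ w : PlacesOver E v, (w.1.adicCompletion E)ˣ →* ℂˣ) (hχ1 : IsTrivialNearOne F E v w (χv w))
    (hU : ImplementerUniqueUpToScalar (localSchrodinger F (n + n) (gramD F n T₀) v))
    (r : ImplementerSection (localSchrodinger F (n + n) (gramD F n T₀) v))
    (hr : ∀ g₁ g₂ : LocalSp F (n + n) (gramD F n T₀) v, r.cocycle hU g₁ g₂ =
      localLeray F (n + n) (gramD F n T₀) (isUnit_det_gramD F n hT₀d) v μ ((adeleAddCharAt F v).mulShift (⅟(2 : (HeightOneSpectrum.adicCompletion F v))))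
        (isContinuousNontrivial_adeleAddCharAt_half F v) (deltaLagrangian F v n) (deltaLagrangian_orthogonal F v n T₀ hT₀d) g₁ g₂) :
    ∀ Φ : SchwartzBruhat (Fin (n + n) → (HeightOneSpectrum.adicCompletion F v)), ∃ U : Subgroup (UnitaryGroup.localPi E c (n + n) JD v),
      IsOpen (U : Set (UnitaryGroup.localPi E c (n + n) JD v)) ∧
        ∀ k ∈ U, ((betaSplitDoubled F E c hcδ hδ hd v μ n hT₀ hT₀d hJD w hw (isContinuousNontrivial_adeleAddCharAt_half F v) χv k)⁻¹ : ℂˣ) •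
          r (iotaD F E c hcδ hδ hd v n hT₀ hJD k) Φ = Φ :=
  fun Φ => smooth_of_parabolicSmooth_split F E c hcδ hδ hd v n hT₀ hT₀d hJD w hw (χv w) hχ1 hU r
    (fun Φ' => L6a_parabolicSmooth F E c hcδ hδ hd v μ n hT₀ hT₀d hJD w hU r hr Φ') _
    (betaSplitDoubled_mul F E c hcδ hδ hd v μ n hT₀ hT₀d hJD w hw χv hU r (isContinuousNontrivial_adeleAddCharAt_half F v) hr)
    (fun p hp => by
      rw [betaSplitDoubled, betaSplit_eq_one_of_map_eq F E c hcδ hδ hd v μ (n + n) (gramD F n T₀) (gramD_isSymm F n hT₀)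
        (isUnit_det_gramD F n hT₀d) hJD (isContinuousNontrivial_adeleAddCharAt_half F v)
        (deltaLagrangian_orthogonal F v n T₀ hT₀d) w hw p hp, one_mul])
    Φ

/-- **THE NON-ARCHIMEDEAN DATUM AT A SPLIT PLACE** for `ℓ_Δ`: `r` from L0 (at some `ψ'`), `β = betaSplitDoubled` at
that `ψ'` (L1 + L1s, `∂β = c`), smoothness L6s. [cite: Kudla1994, Thm 3.1; GelbartRogawski1991, §3.1 Prop. 3.1.1] -/
def localSplittingDatumSplit (hT₀ : T₀.IsSymm) (hT₀d : IsUnit T₀.det) {JD : Matrix (Fin (n + n)) (Fin (n + n)) E} (hJD : JD = (gramD F n T₀).map (algebraMap F E))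
    (w : PlacesOver E v) (hw : c • w.1 ≠ w.1)
    (χv : ∀ w : PlacesOver E v, (w.1.adicCompletion E)ˣ →* ℂˣ) (hχ1 : IsTrivialNearOne F E v w (χv w)) :
    LocalSplittingDatum F E c (n + n) hcδ hδ hd (gramD F n T₀) (gramD_isSymm F n hT₀)
      (isUnit_det_gramD F n hT₀d) hJD v μ (deltaLagrangian F v n) (deltaLagrangian_orthogonal F v n T₀ hT₀d) :=
  let D := L0D F v μ n hT₀d
  { r := D.r
    hU := D.hU
    cocycle_eq := ⟨D.ψ', D.hψ', D.cocycle_eq⟩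
    beta := betaSplitDoubled F E c hcδ hδ hd v μ n hT₀ hT₀d hJD w hw D.hψ' χv
    beta_one := by
      rw [betaSplitDoubled, betaSplit_one F E c hcδ hδ hd v μ (n + n) (gramD F n T₀) (gramD_isSymm F n hT₀)
        (isUnit_det_gramD F n hT₀d) hJD D.hψ' (deltaLagrangian_orthogonal F v n T₀ hT₀d) w hw, one_mul,
        OneMemClass.coe_one, Pi.one_apply, map_one, map_one]
    beta_mul := betaSplitDoubled_mul F E c hcδ hδ hd v μ n hT₀ hT₀d hJD w hw χv D.hU D.r D.hψ' D.cocycle_eq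
    smooth := L6s_smooth F E c hcδ hδ hd v μ n hT₀ hT₀d hJD w hw χv hχ1 D.hU D.r D.cocycle_eq }

/-- **L8s — THE PARABOLIC NORMALISATION at a SPLIT place**: same display for the split datum
(`β|_{P_Δ} = χ_v ∘ det_Δ` by `L1s_parabolic`). [Kudla1994, Thm 3.1; HarrisKudlaSweet1996, §1 (1.15)–(1.16)]. [cite: Kudla1994, Thm 3.1; HarrisKudlaSweet1996, §1 (1.16)] -/
theorem L8s_parabolicNormalised (hT₀ : T₀.IsSymm) (hT₀d : IsUnit T₀.det) {JD : Matrix (Fin (n + n)) (Fin (n + n)) E} (hJD : JD = (gramD F n T₀).map (algebraMap F E))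
    (w : PlacesOver E v) (hw : c • w.1 ≠ w.1)
    (χv : ∀ w : PlacesOver E v, (w.1.adicCompletion E)ˣ →* ℂˣ) (hχ : IsSplitPair F E c v w χv)
    (hχ1 : IsTrivialNearOne F E v w (χv w))
    (δ' : LocalSp F (n + n) (gramD F n T₀) v)
    (hδ' : (deltaLagrangian F v n).map (toLin F v δ') = lagrangianY F (n + n) v)
    (p : UnitaryGroup.localPi E c (n + n) JD v) (hp : IsSiegelDelta F E c hcδ hδ hd v n hT₀ hJD p)
    (Φ : SchwartzBruhat (Fin (n + n) → (HeightOneSpectrum.adicCompletion F v))) :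
    ((((localSplittingDatumSplit F E c hcδ hδ hd v μ n hT₀ hT₀d hJD w hw χv hχ1).r δ')
        ((localSplittingDatumSplit F E c hcδ hδ hd v μ n hT₀ hT₀d hJD w hw χv hχ1).localOmega p
          (((localSplittingDatumSplit F E c hcδ hδ hd v μ n hT₀ hT₀d hJD w hw χv hχ1).r δ').symm Φ)) :
        SchwartzBruhat (Fin (n + n) → (HeightOneSpectrum.adicCompletion F v))) : (Fin (n + n) → (HeightOneSpectrum.adicCompletion F v)) → ℂ) 0 =
      (((chiDet F E c v n χv p)⁻¹ : ℂˣ) : ℂ) * ((∏ w' : PlacesOver E v, Real.sqrt ‖detDelta F E c v n w' p‖ : ℝ) : ℂ) *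
        ((Φ : SchwartzBruhat (Fin (n + n) → (HeightOneSpectrum.adicCompletion F v))) : (Fin (n + n) → (HeightOneSpectrum.adicCompletion F v)) → ℂ) 0 := by
  rw [← L1s_parabolic F E c hcδ hδ hd v μ n hT₀ hT₀d hJD w hw (L0D F v μ n hT₀d).hψ' χv hχ p hp]
  exact parabolicNorm_apply_zero F E c hcδ hδ hd v n hT₀ hT₀d hJD μ _ (L0D F v μ n hT₀d).cocycle_eq δ' hδ' p hp Φ

omit [Algebra.IsQuadraticExtension F E] [MeasurableSpace (HeightOneSpectrum.adicCompletion F v)]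
  [BorelSpace (HeightOneSpectrum.adicCompletion F v)] in
/-- **inverting the local characters inverts `χ_v(det_Δ ·)`**: with the convention `χv w := χ_w⁻¹` the factor
`(chiDet χv p)⁻¹` of L8 is `∏_w χ_w(det_Δ p_w)` (the global `χ(det_Δ ·)` at `v`). [cite: HarrisKudlaSweet1996, §1 (1.15)] -/
theorem chiDet_inv {JD : Matrix (Fin (n + n)) (Fin (n + n)) E}
    (χv : ∀ w : PlacesOver E v, (w.1.adicCompletion E)ˣ →* ℂˣ)
    (h : UnitaryGroup.localPi E c (n + n) JD v) :
    chiDet F E c v n (fun w => (χv w)⁻¹) h = (chiDet F E c v n χv h)⁻¹ := by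
  classical
  unfold chiDet
  rw [← Finset.prod_inv_distrib]
  refine Finset.prod_congr rfl fun w _ => ?_
  split_ifs with hu
  · rw [MonoidHom.inv_apply]
  · rw [inv_one]

end Doubled

/-! ### Build-lane note (ops-buildfix G11b-3 recipe, LEDGER B13-1, 2026-08-21)
`lean -o` (the hub build lane, never `lean`/the gate check) runs Lean 4.32's library-suggestion indexers
(`Lean.LibrarySuggestions.SymbolFrequency` / `SineQuaNon`, from their `exportEntriesFn`) over the statement of
every local theorem that is not a denied premise; on this family's statements (very large dependent binder
telescopes through the theta-kernel / dual-pair data) that fold runs for tens of minutes to hours and the build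
lane kills the job (incident G11b-3, run/shared/lean/ops/buildfix/G11b-3-DOSSIER.md). `isDeniedPremise` skips
`[implicit_reducible]` constants before any fold, and a reducibility status on a *theorem* is inert (Meta never
unfolds `thmInfo`; the kernel ignores the attribute), so the public theorems of this file are tagged
`[implicit_reducible]` purely to keep them out of that index. Only other effect: they are not offered by
`+suggestions` premise selectors. No statement or proof is changed; superseded if the operator lands a
deny-list form (`HarnessLib.PremiseIndex`). -/
set_option allowUnsafeReducibility true in
attribute [implicit_reducible]
  L1s_parabolic betaSplitDoubled_mul L6s_smooth L8s_parabolicNormalised chiDet_inv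

end Literature.NumberTheory.GelbartRogawski1991.UnitaryDualPair.LocalSplitting

end
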